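import Mathlib
import HarnessLib
import Literature.Analysis.Approximation.SchurInequality

/-!
# Orthogonality of the fundamental polynomials at the Chebyshev zeros: Rivlin, Ex. 1.5.20–1.5.21

Source: T. J. Rivlin, *The Chebyshev Polynomials*, Wiley 1974 (held scan
`book:rivlinnd-chebyshev-polynomials`, bib key `Rivlin1974`), Sect. 1.5, "Exercises 1.5
(continued)", Ex. 1.5.20 and Ex. 1.5.21 with (1.124)–(1.125) (p. 29 of the scan), resting on the
Gauss–Chebyshev quadrature formula (1.118)/(1.122).

The text. (1.122) is equivalent to (1.124) `π/n = ∫_{-1}^{1} l_{j,n}(T;x) dx/√(1-x²)` (the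
`l_{j,n}(T;x)` are the fundamental polynomials of Lagrange interpolation at the zeros of the
Chebyshev polynomials). Ex. 1.5.20: `∫_{-1}^{1} l_{j,n}(T;x) l_{k,n}(T;x) dx/√(1-x²) = 0`, `j ≠ k`,
`j, k = 1, …, n`. Ex. 1.5.21: (1.125) `π/n = ∫_{-1}^{1} [l_{j,n}(T;x)]² dx/√(1-x²)`, `j = 1, …, n`
(hint: substitute `p = [l_{j,n}(T;x)]² ∈ 𝒫_{2n-1}` in (1.118); "note the remarkable result implied
by (1.124) and (1.125)"; summing (1.125) on `j` gives
`∫_{-1}^{1} Σ_j [l_{j,n}(T;x)]² dx/√(1-x²) = π`).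

What is here (0-based indices `j, k < n`; `l_{j,n}(T;·)` is Mathlib's
`Lagrange.basis (Finset.range n) (chebyshevZero n) j` with the tree's
`chebyshevZero n j = cos((2j+1)π/(2n))`; the weight `dx/√(1-x²)` on `[-1, 1]` is Mathlib's measure
`Polynomial.Chebyshev.measureT`, and (1.118) is Mathlib's
`Polynomial.Chebyshev.integral_eq_sumZeroes`, USED here, restated only in the tree's node notation
as `integral_measureT_eq_sum_chebyshevZero`):
the node sums `Σ_i l_j(ξ_i) = 1`, `Σ_i l_j(ξ_i) l_k(ξ_i) = [j = k]`; (1.124) `∫ l_j dμ_T = π/n`;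
Ex. 1.5.20/1.5.21 `∫ l_j l_k dμ_T = (π/n)[j = k]`, in particular `= 0` for `j ≠ k` and
`∫ l_j² dμ_T = π/n`; the "remarkable result" `∫ l_j² dμ_T = ∫ l_j dμ_T`; the summed form
`∫ Σ_j l_j² dμ_T = π`; and (1.124), Ex. 1.5.20, (1.125) as printed, as interval integrals
`∫_{-1}^{1} … · (1-x²)^{-1/2} dx` (through Mathlib's `integral_measureT`).

NOT typed: Ex. 1.5.22–1.5.23 (products of `k` fundamental polynomials, the `𝔥`-polynomials) and the
comparison with Ex. 1.4.9.

Honest framing: shared numerical engines serving client cells; rigour lives in the verifiers; every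
published number belongs to a client cell's ledger, not to the engines group.
-/

open Polynomial Polynomial.Chebyshev Real Finset MeasureTheory
open Literature.Analysis.Approximation

namespace Literature.Analysis.Approximation.ChebyshevFundamentalOrthogonality

variable {n j k : ℕ}

/-- Mathlib's `sumZeroes` in terms of the tree's Chebyshev zeros `ξ_{n,i} = cos((2i+1)π/(2n))`:
`sumZeroes n p = (π/n) Σ_{i<n} p(ξ_{n,i})`. [cite: Rivlin1974, Sect. 1.5 (1.118)] -/
theorem sumZeroes_eq_sum_chebyshevZero (n : ℕ) (P : ℝ[X]) :
    sumZeroes n P = π / n * ∑ i ∈ range n, P.eval (chebyshevZero n i) := by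
  unfold sumZeroes chebyshevZero
  congr 1
  refine sum_congr rfl fun i _ => ?_
  rw [div_mul_eq_mul_div]

/-- The Gauss–Chebyshev formula (1.118) (Mathlib's `integral_eq_sumZeroes`) in the tree's notation:
`∫ p dμ_T = (π/n) Σ_{i<n} p(ξ_{n,i})` for `deg p ≤ 2n - 1`, `n ≥ 1`.
[cite: Rivlin1974, Sect. 1.5 (1.118), (1.122)] -/
theorem integral_measureT_eq_sum_chebyshevZero (hn : n ≠ 0) {P : ℝ[X]}
    (hP : P.natDegree ≤ 2 * n - 1) :
    ∫ x, P.eval x ∂measureT = π / n * ∑ i ∈ range n, P.eval (chebyshevZero n i) := by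
  rw [← sumZeroes_eq_sum_chebyshevZero]
  refine integral_eq_sumZeroes hn ?_
  exact lt_of_le_of_lt (degree_le_of_natDegree_le hP)
    (by exact_mod_cast (by omega : 2 * n - 1 < 2 * n))

/-- The fundamental polynomial `l_{j,n}(T;·)` has degree `n - 1`.
[cite: Rivlin1974, Sect. 1.5 Ex. 1.5.21 (hint)] -/
theorem natDegree_basis_chebyshevZero (hj : j < n) :
    (Lagrange.basis (range n) (chebyshevZero n) j).natDegree = n - 1 := by
  rw [Lagrange.natDegree_basis (injOn_chebyshevZero n) (mem_range.mpr hj), card_range]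

/-- `Σ_i l_j(ξ_i) = 1`: only the `i = j` term survives.
[cite: Rivlin1974, Sect. 1.5 (1.122), (1.124)] -/
theorem sum_basis_eval_chebyshevZero (hj : j < n) :
    ∑ i ∈ range n, (Lagrange.basis (range n) (chebyshevZero n) j).eval (chebyshevZero n i) = 1 := by
  rw [sum_eq_single_of_mem j (mem_range.mpr hj) fun i hi hij =>
    Lagrange.eval_basis_of_ne (Ne.symm hij) hi]
  exact Lagrange.eval_basis_self (injOn_chebyshevZero n) (mem_range.mpr hj)

/-- (1.124): `∫ l_{j,n}(T;·) dμ_T = π/n` (equivalent to the Gauss–Chebyshev weights (1.122)).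
[cite: Rivlin1974, Sect. 1.5 (1.124)] -/
theorem integral_basis_measureT (hj : j < n) :
    ∫ x, (Lagrange.basis (range n) (chebyshevZero n) j).eval x ∂measureT = π / n := by
  have hn : n ≠ 0 := by omega
  rw [integral_measureT_eq_sum_chebyshevZero hn (by rw [natDegree_basis_chebyshevZero hj]; omega),
    sum_basis_eval_chebyshevZero hj, mul_one]

/-- `Σ_i l_j(ξ_i) l_k(ξ_i) = [j = k]`.
[cite: Rivlin1974, Sect. 1.5 Ex. 1.5.20, Ex. 1.5.21 (hint)] -/
theorem sum_basis_mul_basis_eval_chebyshevZero (hj : j < n) (hk : k < n) :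
    ∑ i ∈ range n, (Lagrange.basis (range n) (chebyshevZero n) j *
      Lagrange.basis (range n) (chebyshevZero n) k).eval (chebyshevZero n i) =
      if j = k then 1 else 0 := by
  simp_rw [eval_mul]
  rw [sum_eq_single_of_mem j (mem_range.mpr hj) fun i hi hij => by
    rw [Lagrange.eval_basis_of_ne (Ne.symm hij) hi, zero_mul]]
  rw [Lagrange.eval_basis_self (injOn_chebyshevZero n) (mem_range.mpr hj), one_mul]
  split_ifs with h
  · subst h; exact Lagrange.eval_basis_self (injOn_chebyshevZero n) (mem_range.mpr hj)
  · exact Lagrange.eval_basis_of_ne (Ne.symm h) (mem_range.mpr hj)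

/-- Ex. 1.5.20 and Ex. 1.5.21 together: `∫ l_j l_k dμ_T = (π/n) [j = k]`.
[cite: Rivlin1974, Sect. 1.5 Ex. 1.5.20, Ex. 1.5.21] -/
theorem integral_basis_mul_basis_measureT (hj : j < n) (hk : k < n) :
    ∫ x, (Lagrange.basis (range n) (chebyshevZero n) j *
      Lagrange.basis (range n) (chebyshevZero n) k).eval x ∂measureT =
      if j = k then π / n else 0 := by
  have hn : n ≠ 0 := by omega
  have hdeg : (Lagrange.basis (range n) (chebyshevZero n) j *
      Lagrange.basis (range n) (chebyshevZero n) k).natDegree ≤ 2 * n - 1 := by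
    refine natDegree_mul_le.trans ?_
    rw [natDegree_basis_chebyshevZero hj, natDegree_basis_chebyshevZero hk]; omega
  rw [integral_measureT_eq_sum_chebyshevZero hn hdeg, sum_basis_mul_basis_eval_chebyshevZero hj hk]
  split_ifs <;> simp

/-- Ex. 1.5.20: the fundamental polynomials at the Chebyshev zeros are orthogonal for `dx/√(1-x²)`:
`∫ l_j l_k dμ_T = 0` for `j ≠ k`. [cite: Rivlin1974, Sect. 1.5 Ex. 1.5.20] -/
theorem integral_basis_mul_basis_measureT_of_ne (hj : j < n) (hk : k < n) (hjk : j ≠ k) :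
    ∫ x, (Lagrange.basis (range n) (chebyshevZero n) j *
      Lagrange.basis (range n) (chebyshevZero n) k).eval x ∂measureT = 0 := by
  rw [integral_basis_mul_basis_measureT hj hk, if_neg hjk]

/-- Ex. 1.5.21 (1.125): `∫ [l_{j,n}(T;·)]² dμ_T = π/n`.
[cite: Rivlin1974, Sect. 1.5 Ex. 1.5.21 (1.125)] -/
theorem integral_basis_sq_measureT (hj : j < n) :
    ∫ x, ((Lagrange.basis (range n) (chebyshevZero n) j) ^ 2).eval x ∂measureT = π / n := by
  rw [pow_two, integral_basis_mul_basis_measureT hj hj, if_pos rfl]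

/-- The "remarkable result implied by (1.124) and (1.125)": `∫ l_j² dμ_T = ∫ l_j dμ_T`.
[cite: Rivlin1974, Sect. 1.5 Ex. 1.5.21] -/
theorem integral_basis_sq_eq_integral_basis_measureT (hj : j < n) :
    ∫ x, ((Lagrange.basis (range n) (chebyshevZero n) j) ^ 2).eval x ∂measureT =
      ∫ x, (Lagrange.basis (range n) (chebyshevZero n) j).eval x ∂measureT := by
  rw [integral_basis_sq_measureT hj, integral_basis_measureT hj]

/-- Summing (1.125) over `j`: `∫ Σ_j [l_{j,n}(T;·)]² dμ_T = π` (`n ≥ 1`).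
[cite: Rivlin1974, Sect. 1.5 Ex. 1.5.21] -/
theorem integral_sum_basis_sq_measureT (hn : n ≠ 0) :
    ∫ x, (∑ j ∈ range n, (Lagrange.basis (range n) (chebyshevZero n) j) ^ 2).eval x ∂measureT =
      π := by
  have hdeg : (∑ j ∈ range n, (Lagrange.basis (range n) (chebyshevZero n) j) ^ 2).natDegree ≤
      2 * n - 1 := by
    refine natDegree_sum_le_of_forall_le _ _ fun j hj => natDegree_pow_le.trans ?_
    rw [natDegree_basis_chebyshevZero (mem_range.mp hj)]; omega
  rw [integral_measureT_eq_sum_chebyshevZero hn hdeg]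
  simp_rw [eval_finsetSum, eval_pow]
  have hinner : ∀ i ∈ range n, ∑ j ∈ range n,
      ((Lagrange.basis (range n) (chebyshevZero n) j).eval (chebyshevZero n i)) ^ 2 = 1 := by
    intro i hi
    rw [sum_eq_single_of_mem i hi fun j hj hji => by
      rw [Lagrange.eval_basis_of_ne hji hi, zero_pow two_ne_zero],
      Lagrange.eval_basis_self (injOn_chebyshevZero n) hi, one_pow]
  rw [sum_congr rfl hinner, sum_const, card_range, nsmul_eq_mul, mul_one]
  have hn' : (n : ℝ) ≠ 0 := Nat.cast_ne_zero.mpr hn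
  field_simp

/-! ### The same statements as integrals over `[-1, 1]` -/

/-- (1.124) as printed: `∫_{-1}^{1} l_{j,n}(T;x) dx/√(1-x²) = π/n`.
[cite: Rivlin1974, Sect. 1.5 (1.124)] -/
theorem integral_basis_div_sqrt (hj : j < n) :
    ∫ x in -1..1, (Lagrange.basis (range n) (chebyshevZero n) j).eval x * √(1 - x ^ 2)⁻¹ =
      π / n := by
  rw [← integral_measureT, integral_basis_measureT hj]

/-- Ex. 1.5.20 as printed: `∫_{-1}^{1} l_{j,n}(T;x) l_{k,n}(T;x) dx/√(1-x²) = 0`, `j ≠ k`.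
[cite: Rivlin1974, Sect. 1.5 Ex. 1.5.20] -/
theorem integral_basis_mul_basis_div_sqrt_of_ne (hj : j < n) (hk : k < n) (hjk : j ≠ k) :
    ∫ x in -1..1, (Lagrange.basis (range n) (chebyshevZero n) j).eval x *
      (Lagrange.basis (range n) (chebyshevZero n) k).eval x * √(1 - x ^ 2)⁻¹ = 0 := by
  have h := integral_basis_mul_basis_measureT_of_ne hj hk hjk
  rw [integral_measureT] at h
  simpa only [eval_mul] using h

/-- Ex. 1.5.21 (1.125) as printed: `∫_{-1}^{1} [l_{j,n}(T;x)]² dx/√(1-x²) = π/n`.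
[cite: Rivlin1974, Sect. 1.5 Ex. 1.5.21 (1.125)] -/
theorem integral_basis_sq_div_sqrt (hj : j < n) :
    ∫ x in -1..1, ((Lagrange.basis (range n) (chebyshevZero n) j).eval x) ^ 2 * √(1 - x ^ 2)⁻¹ =
      π / n := by
  have h := integral_basis_sq_measureT hj
  rw [integral_measureT] at h
  simpa only [eval_pow] using h

end Literature.Analysis.Approximation.ChebyshevFundamentalOrthogonality
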